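import Mathlib
import HarnessLib
import Literature.Computability.AlgebraicComplexity.BKRRSS25ConstantDepthFactorClosure
import Summits.ValiantsHypothesis.ValiantsHypothesis.Theorems.DefinabilityGapK1ConstDepthRung

/-!
# DefinabilityGap — the constant-depth rung `K1cd` of `K1 = KIPlantedHitting`, modulo the NAMED fact
# `Literature.Computability.AlgebraicComplexity.BhattacharjeeEtAl2025_thm1`
# (support for item `stmt-ValiantsHypothesis-23547`; decomp-valiant census instrument, generation 19)

Bookkeeping bridge (no new mathematics): lens 5's kernel
`DefinabilityGapK1ConstDepthRung.kiPlantedHittingCD_of_cdFactorClosure` (p771224) proves the constant-depth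
rung of `K1` from the 2025 closure theorem of Bhattacharjee–Kumar–Rai–Ramanathan–Saptharishi–Saraf
SPELLED OUT as its hypothesis `hfac`; the census typed that hypothesis as the Literature named fact
`BhattacharjeeEtAl2025_thm1` (same binders, verbatim). This file records the rung in the form
"named fact → K1cd", so that the ledger sees a CONDITIONAL result on ONE citable print theorem
[BhattacharjeeEtAl2025, Thm. 1] rather than an anonymous hypothesis. Honest framing: a rung (S-implied
slice of `K1`), conditional on a 2025 theorem that is stated, not proved, in the tree; `VP ≠ VNP` untouched.
-/

set_option linter.dupNamespace false

noncomputable section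

open MvPolynomial
open Literature.Computability.AlgebraicComplexity Literature.Computability.MetaComplexity
open Summit.ValiantsHypothesis.ValiantsHypothesis.Theorems.DefinabilityGapAffineRung (qOf kiPer)
open Summit.ValiantsHypothesis.ValiantsHypothesis.Theorems.DefinabilityGapK1ConstDepthRung
  (kiPlantedHittingCD_of_cdFactorClosure)

namespace Summit.ValiantsHypothesis.ValiantsHypothesis.Theorems.DefinabilityGapK1cdOfBKRRSS25

/-- **`K1cd` modulo the named fact [BhattacharjeeEtAl2025, Thm. 1].** For every product-depth `Δ`, size
exponent `b` and `m₀` there is `m ≥ m₀` such that the KI-planted permanent map `G_m = kiPer m` hits every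
nonzero `D` of degree `≤ q^b` computed by an unbounded-fan-in circuit of product-depth `≤ Δ` with `≤ q^b`
wires (`q = qOf m`) — from `BhattacharjeeEtAl2025_thm1` (constant-depth factor closure, (product-depth,
wires) form) by lens 5's `kiPlantedHittingCD_of_cdFactorClosure`. CONDITIONAL on the named fact.
[cite: BhattacharjeeEtAl2025, Thm. 1, Thm. 37] [cite: KabanetsImpagliazzo2003, Thm. 7.7] -/
theorem kiPlantedHittingCD_of_bkrrss25 (h : BhattacharjeeEtAl2025_thm1) :
    ∀ Δ b m₀ : ℕ, ∃ m, m₀ ≤ m ∧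
      ∀ (Γ : ArithCircuit ℂ (Fin 3 → Fin (qOf m))) (D : MvPolynomial (Fin 3 → Fin (qOf m)) ℂ),
        Γ.Computes D → Γ.productDepth ≤ Δ → Γ.edgeSize ≤ qOf m ^ b → D ≠ 0 → D.totalDegree ≤ qOf m ^ b →
        bind₁ (kiPer m) D ≠ 0 :=
  kiPlantedHittingCD_of_cdFactorClosure h

end Summit.ValiantsHypothesis.ValiantsHypothesis.Theorems.DefinabilityGapK1cdOfBKRRSS25

end
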